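import Literature.NumberTheory.LFunctions.RudnickSarnakGlue
import Literature.NumberTheory.LFunctions.RudnickSarnakMerge
import Literature.NumberTheory.LFunctions.RudnickSarnakUnique
import HarnessLib

/-!
# The pairing functional of a fibre integral, stratum by stratum

Rudnick–Sarnak, Duke Math. J. **81** (1996), Lemma 4.1 and (4.13)–(4.14): for a set partition
`Q` of `Fin (k + 1)` with block labels `ι`, one term of the pairing functional (3.9) of the fibre
integral `Φ_Q` (the pull-back `ι_Q^* f_Φ = f_{Φ_Q}`, (4.14)) attached to a partial matching `M` of
the labels,
`T_M(Φ_Q) = ∫ ∏_{p ∈ M} |v_p| Φ_Q(∑_p v_p e_{p.1, p.2}) dv`,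
is an integral of `Φ` over the stratum `H_G` of the coarsening `G = mergeBy ι M` of `Q` (the
pairs of blocks matched by `M` merged) against the density `∏ |block sums|`:

* `integral_matching_fibreIntegral` :
  `T_M(Φ_Q) = ∫_{u' ∈ ℝ^{Free G}} dens Q G (extG G u') · Φ(extG G u') du'`,
  `dens Q G u = ∏_{j new free} |∑_{i ∈ Q.part j} u_i|`.

This is the content of "`∫ Φ(u) C_F(u) du := ∫ Φ_F(u) C_O(u) du`" ((4.13)) combined with
Theorem 3.2's description (3.9) of `C_O`, on the stratum of the marked partition `(Q, M)`.
The proof is the gluing change of variables of `RudnickSarnakGlue.lean` after matching the pairs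
`p ∈ M` with the new free representatives (`demRepEquiv`) and flipping signs.

## References

* Z. Rudnick, P. Sarnak, Duke Math. J. 81 (1996), (3.9), Lemma 4.1, (4.13)–(4.14).
-/

noncomputable section

open MeasureTheory Finset

namespace Literature.NumberTheory.LFunctions

namespace RudnickSarnak

variable {k m : ℕ} (Q : Finpartition (univ : Finset (Fin (k + 1)))) (ι : Fin (k + 1) → Fin (m + 1))
  (hι : ∀ a b : Fin (k + 1), ι a = ι b ↔ Q.part a = Q.part b) (hιs : Function.Surjective ι)

/-! ## Representatives of labelled blocks -/

section reps

include hιs in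
/-- The fibre of a label is nonempty. [folklore] -/
theorem filter_label_nonempty (b : Fin (m + 1)) : (univ.filter fun j ↦ ι j = b).Nonempty := by
  obtain ⟨a, ha⟩ := hιs b
  exact ⟨a, by simp [ha]⟩

/-- The representative (least element) of the block with label `b`. [folklore] -/
def repOfLabel (hιs : Function.Surjective ι) (b : Fin (m + 1)) : Fin (k + 1) :=
  (univ.filter fun j ↦ ι j = b).min' (filter_label_nonempty ι hιs b)

/-- [folklore] -/
theorem label_repOfLabel (b : Fin (m + 1)) : ι (repOfLabel ι hιs b) = b := by
  have := Finset.min'_mem _ (filter_label_nonempty ι hιs b)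
  exact (Finset.mem_filter.1 this).2

/-- [folklore] -/
theorem repOfLabel_le {b : Fin (m + 1)} {j : Fin (k + 1)} (hj : ι j = b) : repOfLabel ι hιs b ≤ j :=
  Finset.min'_le _ _ (by simp [hj])

include hι in
/-- A block is the fibre of its label. [folklore] -/
theorem part_eq_filter_label (a : Fin (k + 1)) : Q.part a = univ.filter fun j ↦ ι j = ι a := by
  ext j
  simp [mem_part_iff_label_eq Q ι hι]

include hι in
/-- The representative of a block in terms of its label. [folklore] -/
theorem rep_eq_repOfLabel (a : Fin (k + 1)) : rep Q a = repOfLabel ι hιs (ι a) := by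
  unfold rep repOfLabel
  congr 1
  exact part_eq_filter_label Q ι hι a

include hι in
/-- `repOfLabel b` is a representative of `Q`. [folklore] -/
theorem isRep_repOfLabel (b : Fin (m + 1)) : IsRep Q (repOfLabel ι hιs b) := by
  unfold IsRep
  rw [rep_eq_repOfLabel Q ι hι hιs, label_repOfLabel ι hιs b]

include hι in
/-- A representative is the representative of its label. [folklore] -/
theorem repOfLabel_label_of_isRep {r : Fin (k + 1)} (hr : IsRep Q r) : repOfLabel ι hιs (ι r) = r := by
  rw [← rep_eq_repOfLabel Q ι hι hιs]
  exact hr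

/-- Labels of distinct pairs… the two representatives of a pair are distinct. [folklore] -/
theorem repOfLabel_ne {b b' : Fin (m + 1)} (h : b ≠ b') : repOfLabel ι hιs b ≠ repOfLabel ι hιs b' := by
  intro h'
  apply h
  calc b = ι (repOfLabel ι hιs b) := (label_repOfLabel ι hιs b).symm
    _ = ι (repOfLabel ι hιs b') := by rw [h']
    _ = b' := label_repOfLabel ι hιs b'

end reps

/-! ## Matched pairs and the new free representatives of the merged partition -/

section pairs

variable {M : Finset (Fin (m + 1) × Fin (m + 1))} (hM : IsPartialMatching M)
include hM

/-- The class of a matched label. [folklore] -/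
theorem mRel_iff_of_mem {p : Fin (m + 1) × Fin (m + 1)} (hp : p ∈ M) {x : Fin (m + 1)}
    (hx : x = p.1 ∨ x = p.2) (y : Fin (m + 1)) : MRel M x y ↔ (y = p.1 ∨ y = p.2) := by
  constructor
  · rintro (rfl | h | h)
    · exact hx
    · have := IsPartialMatching.eq_of_mem_mem hM h hp (x := x) (by simp)
        (by rcases hx with rfl | rfl <;> simp)
      subst this
      exact Or.inr rfl
    · have := IsPartialMatching.eq_of_mem_mem hM h hp (x := x) (by simp)
        (by rcases hx with rfl | rfl <;> simp)
      subst this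
      exact Or.inl rfl
  · intro hy
    rcases hx with rfl | rfl <;> rcases hy with rfl | rfl
    · exact Or.inl rfl
    · exact Or.inr (Or.inl hp)
    · exact Or.inr (Or.inr hp)
    · exact Or.inl rfl

omit hM in
/-- An unmatched label is alone in its class. [folklore] -/
theorem mRel_iff_eq_of_forall {x : Fin (m + 1)} (hx : ∀ p ∈ M, x ≠ p.1 ∧ x ≠ p.2) (y : Fin (m + 1)) :
    MRel M x y ↔ y = x := by
  constructor
  · rintro (rfl | h | h)
    · rfl
    · exact absurd rfl (hx _ h).1
    · exact absurd rfl (hx _ h).2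
  · rintro rfl
    exact Or.inl rfl

/-- The merged block of a matched pair is the union of the two labelled blocks. [folklore] -/
theorem mem_part_mergeBy_of_mem {p : Fin (m + 1) × Fin (m + 1)} (hp : p ∈ M) {a : Fin (k + 1)}
    (ha : ι a = p.1 ∨ ι a = p.2) (j : Fin (k + 1)) :
    j ∈ (mergeBy ι M).part a ↔ (ι j = p.1 ∨ ι j = p.2) := by
  rw [mem_part_mergeBy ι hM, mRel_iff_of_mem hM hp ha]

/-- The representative of the merged block of a matched pair is the smaller of the two
representatives. [folklore] -/
theorem rep_mergeBy_of_mem {p : Fin (m + 1) × Fin (m + 1)} (hp : p ∈ M) {a : Fin (k + 1)}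
    (ha : ι a = p.1 ∨ ι a = p.2) :
    rep (mergeBy ι M) a = min (repOfLabel ι hιs p.1) (repOfLabel ι hιs p.2) := by
  refine le_antisymm (le_min ?_ ?_) ?_
  · exact rep_le _ ((mem_part_mergeBy_of_mem ι hM hp ha _).2 (Or.inl (label_repOfLabel ι hιs _)))
  · exact rep_le _ ((mem_part_mergeBy_of_mem ι hM hp ha _).2 (Or.inr (label_repOfLabel ι hιs _)))
  · have hmem := rep_mem (mergeBy ι M) a
    rcases (mem_part_mergeBy_of_mem ι hM hp ha _).1 hmem with h | h
    · exact (min_le_left _ _).trans (repOfLabel_le ι hιs h)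
    · exact (min_le_right _ _).trans (repOfLabel_le ι hιs h)

/-- The demoted representative of a matched pair: the larger of the two representatives.
[cite: RudnickSarnak1996, proof of Prop 4.1] -/
def demRep (p : M) : Fin (k + 1) := max (repOfLabel ι hιs p.1.1) (repOfLabel ι hιs p.1.2)

omit hM in
/-- The label of the demoted representative is one of the two labels. [folklore] -/
theorem label_demRep (p : M) : ι (demRep ι hιs p) = p.1.1 ∨ ι (demRep ι hιs p) = p.1.2 := by
  unfold demRep
  rcases max_choice (repOfLabel ι hιs p.1.1) (repOfLabel ι hιs p.1.2) with h | h <;> rw [h]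
  · exact Or.inl (label_repOfLabel ι hιs _)
  · exact Or.inr (label_repOfLabel ι hιs _)

include hι in
/-- The demoted representative is a new free index of the merged partition. [folklore] -/
theorem demRep_mem_newFree (p : M) :
    IsRep Q (demRep ι hιs p) ∧ ¬IsRep (mergeBy ι M) (demRep ι hιs p) := by
  constructor
  · unfold demRep
    rcases max_choice (repOfLabel ι hιs p.1.1) (repOfLabel ι hιs p.1.2) with h | h <;> rw [h] <;>
      exact isRep_repOfLabel Q ι hι hιs _
  · unfold IsRep
    rw [rep_mergeBy_of_mem ι hιs hM p.2 (label_demRep ι hιs p), demRep]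
    have hne : repOfLabel ι hιs p.1.1 ≠ repOfLabel ι hιs p.1.2 :=
      repOfLabel_ne ι hιs (hM.1 p.1 p.2).ne
    rcases lt_or_gt_of_ne hne with h | h
    · rw [min_eq_left h.le, max_eq_right h.le]
      exact h.ne
    · rw [min_eq_right h.le, max_eq_left h.le]
      exact h.ne

include hι in
/-- **Matched pairs ≃ new free representatives of the merged partition.**
[cite: RudnickSarnak1996, proof of Prop 4.1] -/
def demRepEquiv : M ≃ NewFree Q (mergeBy ι M) :=
  Equiv.ofBijective (fun p ↦ ⟨demRep ι hιs p, demRep_mem_newFree Q ι hι hιs hM p⟩)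
    (by
      constructor
      · intro p q h
        have h' : demRep ι hιs p = demRep ι hιs q := congrArg Subtype.val h
        apply Subtype.ext
        refine IsPartialMatching.eq_of_mem_mem hM p.2 q.2 (x := ι (demRep ι hιs p)) ?_ ?_
        · rcases label_demRep ι hιs p with h1 | h1 <;> simp [h1]
        · rw [h']
          rcases label_demRep ι hιs q with h1 | h1 <;> simp [h1]
      · rintro ⟨j, hjQ, hjG⟩
        -- the label of `j` is matched
        have hex : ∃ p ∈ M, ι j = p.1 ∨ ι j = p.2 := by
          by_contra hno
          push Not at hno
          apply hjG
          have hpart : (mergeBy ι M).part j = Q.part j := by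
            ext i
            rw [mem_part_mergeBy ι hM, mRel_iff_eq_of_forall (fun p hp ↦ hno p hp),
              mem_part_iff_label_eq Q ι hι]
          have hrep : rep (mergeBy ι M) j = rep Q j := by
            unfold rep
            congr 1
          exact hrep.trans hjQ
        obtain ⟨p, hp, hjp⟩ := hex
        refine ⟨⟨p, hp⟩, Subtype.ext ?_⟩
        simp only [demRep]
        have hrj : repOfLabel ι hιs (ι j) = j := repOfLabel_label_of_isRep Q ι hι hιs hjQ
        have hGj : rep (mergeBy ι M) j ≠ j := hjG
        rw [rep_mergeBy_of_mem ι hιs hM hp hjp] at hGj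
        rcases hjp with h | h <;> rw [h] at hrj
        · rw [hrj] at hGj ⊢
          rcases le_total j (repOfLabel ι hιs p.2) with h2 | h2
          · exact absurd (min_eq_left h2) hGj
          · exact max_eq_left h2
        · rw [hrj] at hGj ⊢
          rcases le_total j (repOfLabel ι hιs p.1) with h2 | h2
          · rw [min_comm] at hGj
            exact absurd (min_eq_left h2) hGj
          · exact max_eq_right h2)

include hι in
/-- [folklore] -/
theorem demRepEquiv_apply (p : M) : (demRepEquiv Q ι hι hιs hM p : Fin (k + 1)) = demRep ι hιs p := rfl

end pairs

/-! ## The point `∑_p v_p e_{p.1, p.2}` of a matching -/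

/-- The point `∑_{p ∈ M} v_p e_{p.1, p.2}` of RS (3.9). [cite: RudnickSarnak1996, (3.9)–(3.10)] -/
def pairPoint (M : Finset (Fin (m + 1) × Fin (m + 1))) (v : M → ℝ) : Fin (m + 1) → ℝ :=
  ∑ p : M, v p • rsBasisDiff (p : Fin (m + 1) × Fin (m + 1))

/-- Coordinates of the pairing point. [folklore] -/
theorem pairPoint_apply (M : Finset (Fin (m + 1) × Fin (m + 1))) (v : M → ℝ) (b : Fin (m + 1)) :
    pairPoint M v b = ∑ p : M, v p * ((if b = p.1.1 then 1 else 0) - (if b = p.1.2 then 1 else 0)) := by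
  unfold pairPoint rsBasisDiff
  simp only [Finset.sum_apply, Pi.smul_apply, Pi.sub_apply, smul_eq_mul, Pi.single_apply]

section pairCoords

variable {M : Finset (Fin (m + 1) × Fin (m + 1))} (hM : IsPartialMatching M)
include hM

/-- The coordinate at the smaller label of a pair is `v_p`. [folklore] -/
theorem pairPoint_apply_fst (v : M → ℝ) (q : M) : pairPoint M v q.1.1 = v q := by
  rw [pairPoint_apply, Finset.sum_eq_single q]
  · have : q.1.1 ≠ q.1.2 := (hM.1 q.1 q.2).ne
    simp [this]
  · intro p _ hpq
    have h1 : q.1.1 ≠ p.1.1 := fun h ↦ hpq (Subtype.ext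
      (IsPartialMatching.eq_of_mem_mem hM p.2 q.2 (x := q.1.1) (by simp [h]) (by simp)))
    have h2 : q.1.1 ≠ p.1.2 := fun h ↦ hpq (Subtype.ext
      (IsPartialMatching.eq_of_mem_mem hM p.2 q.2 (x := q.1.1) (by simp [h]) (by simp)))
    simp [h1, h2]
  · simp

/-- The coordinate at the larger label of a pair is `-v_p`. [folklore] -/
theorem pairPoint_apply_snd (v : M → ℝ) (q : M) : pairPoint M v q.1.2 = -v q := by
  rw [pairPoint_apply, Finset.sum_eq_single q]
  · have : q.1.2 ≠ q.1.1 := (hM.1 q.1 q.2).ne'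
    simp [this]
  · intro p _ hpq
    have h1 : q.1.2 ≠ p.1.1 := fun h ↦ hpq (Subtype.ext
      (IsPartialMatching.eq_of_mem_mem hM p.2 q.2 (x := q.1.2) (by simp [h]) (by simp)))
    have h2 : q.1.2 ≠ p.1.2 := fun h ↦ hpq (Subtype.ext
      (IsPartialMatching.eq_of_mem_mem hM p.2 q.2 (x := q.1.2) (by simp [h]) (by simp)))
    simp [h1, h2]
  · simp

omit hM in
/-- The coordinate at an unmatched label is `0`. [folklore] -/
theorem pairPoint_apply_of_forall (v : M → ℝ) {b : Fin (m + 1)} (hb : ∀ p ∈ M, b ≠ p.1 ∧ b ≠ p.2) :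
    pairPoint M v b = 0 := by
  rw [pairPoint_apply]
  refine Finset.sum_eq_zero fun p _ ↦ ?_
  simp [(hb p.1 p.2).1, (hb p.1 p.2).2]

omit hM in
/-- The coordinates of the pairing point sum to zero. [folklore] -/
theorem sum_pairPoint (v : M → ℝ) : ∑ b, pairPoint M v b = 0 := by
  simp only [pairPoint_apply]
  rw [Finset.sum_comm]
  refine Finset.sum_eq_zero fun p _ ↦ ?_
  rw [← Finset.mul_sum, Finset.sum_sub_distrib, Finset.sum_ite_eq', Finset.sum_ite_eq']
  simp

/-- **The sum of the coordinates over a root class vanishes** (the two labels of a pair have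
the same root). [folklore] -/
theorem sum_filter_rootM_pairPoint (v : M → ℝ) (r : Fin (m + 1)) :
    ∑ b ∈ univ.filter (fun b ↦ rootM M b = r), pairPoint M v b = 0 := by
  simp only [pairPoint_apply]
  rw [Finset.sum_comm]
  refine Finset.sum_eq_zero fun p _ ↦ ?_
  rw [← Finset.mul_sum, Finset.sum_sub_distrib, Finset.sum_ite_eq', Finset.sum_ite_eq']
  simp only [Finset.mem_filter, Finset.mem_univ, true_and]
  rw [rootM_eq_self_of_fst hM p.2, rootM_eq_fst hM p.2]
  simp

end pairCoords

/-! ## The pairing term as an integral over the merged stratum -/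

/-- The density `∏_{j new free} |∑_{i ∈ Q.part j} u_i|` on the stratum `H_G`.
[cite: RudnickSarnak1996, Lemma 4.1] -/
def dens (G : Finpartition (univ : Finset (Fin (k + 1)))) (u : Fin (k + 1) → ℝ) : ℝ :=
  ∏ j : NewFree Q G, |∑ i ∈ Q.part j.1, u i|

/-- The density is continuous. [folklore] -/
theorem continuous_dens (G : Finpartition (univ : Finset (Fin (k + 1)))) : Continuous (dens Q G) := by
  unfold dens
  refine continuous_finsetProd _ fun j _ ↦ ?_
  exact (continuous_finsetSum _ fun i _ ↦ continuous_apply i).abs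

/-- Free coordinates are bounded by the norm of the stratum point. [folklore] -/
theorem norm_le_norm_extG (G : Finpartition (univ : Finset (Fin (k + 1)))) (u' : Free G → ℝ) :
    ‖u'‖ ≤ ‖extG G u'‖ := by
  rw [pi_norm_le_iff_of_nonneg (norm_nonneg _)]
  intro j
  have := norm_le_pi_norm (extG G u') j
  rwa [extG_apply_free] at this

/-- A compactly supported function composed with `extG` is compactly supported. [folklore] -/
theorem hasCompactSupport_comp_extG (G : Finpartition (univ : Finset (Fin (k + 1)))) {E : Type*}
    [Zero E] [TopologicalSpace E] {F : (Fin (k + 1) → ℝ) → E}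
    (hF : HasCompactSupport F) : HasCompactSupport fun u' : Free G → ℝ ↦ F (extG G u') := by
  obtain ⟨R, hR⟩ := hF.isCompact.isBounded.subset_closedBall 0
  refine HasCompactSupport.of_support_subset_isCompact (isCompact_closedBall (0 : Free G → ℝ) R)
    fun u' hu' ↦ ?_
  have hmem := hR (subset_tsupport _ (Function.mem_support.2 hu'))
  rw [Metric.mem_closedBall, dist_zero_right] at hmem ⊢
  exact (norm_le_norm_extG G u').trans hmem

section main

variable {M : Finset (Fin (m + 1) × Fin (m + 1))} (hM : IsPartialMatching M)
include hι hιs hM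

/-- The sign attached to a pair: `+1` if the demoted representative carries the smaller label.
[folklore] -/
def pairSign (p : M) : ℝ := if ι (demRep ι hιs p) = p.1.1 then 1 else -1

omit hι hM in
/-- [folklore] -/
theorem pairSign_mul_self (p : M) : pairSign ι hιs p * pairSign ι hιs p = 1 := by
  unfold pairSign
  split_ifs <;> norm_num

omit hι hM in
/-- [folklore] -/
theorem abs_pairSign_mul (p : M) (x : ℝ) : |pairSign ι hιs p * x| = |x| := by
  unfold pairSign
  split_ifs <;> simp

/-- The substitution `t ↦ v`, `v_p = ε_p t_{demRep p}`. [folklore] -/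
def pairSubst (t : NewFree Q (mergeBy ι M) → ℝ) (p : M) : ℝ :=
  pairSign ι hιs p * t (demRepEquiv Q ι hι hιs hM p)

/-- The substitution preserves Lebesgue measure (a reindexing followed by sign flips).
[folklore] -/
theorem measurePreserving_pairSubst :
    MeasurePreserving (pairSubst Q ι hι hιs hM) (volume : Measure (NewFree Q (mergeBy ι M) → ℝ))
      (volume : Measure (M → ℝ)) := by
  have h1 : MeasurePreserving
      (MeasurableEquiv.piCongrLeft (fun _ : M ↦ ℝ) (demRepEquiv Q ι hι hιs hM).symm)
      (volume : Measure (NewFree Q (mergeBy ι M) → ℝ)) (volume : Measure (M → ℝ)) :=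
    volume_measurePreserving_piCongrLeft (fun _ : M ↦ ℝ) _
  have h2 : MeasurePreserving (fun (v : M → ℝ) (p : M) ↦ pairSign ι hιs p * v p)
      (volume : Measure (M → ℝ)) (volume : Measure (M → ℝ)) := by
    refine volume_preserving_pi (fun p ↦ ?_)
    by_cases h : ι (demRep ι hιs p) = p.1.1
    · have : (HMul.hMul (pairSign ι hιs p) : ℝ → ℝ) = id := by
        funext x
        simp [pairSign, h]
      rw [this]
      exact MeasurePreserving.id (volume : Measure ℝ)
    · have : (HMul.hMul (pairSign ι hιs p) : ℝ → ℝ) = Neg.neg := by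
        funext x
        simp [pairSign, h]
      rw [this]
      exact Measure.measurePreserving_neg (volume : Measure ℝ)
  have heq : pairSubst Q ι hι hιs hM = (fun (v : M → ℝ) (p : M) ↦ pairSign ι hιs p * v p) ∘
      (MeasurableEquiv.piCongrLeft (fun _ : M ↦ ℝ) (demRepEquiv Q ι hι hιs hM).symm) := by
    funext t p
    simp only [Function.comp_apply, pairSubst]
    congr 1
    have := MeasurableEquiv.piCongrLeft_apply_apply (demRepEquiv Q ι hι hιs hM).symm
      (β := fun _ : M ↦ ℝ) t (demRepEquiv Q ι hι hιs hM p)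
    rw [Equiv.symm_apply_apply] at this
    exact this.symm
  rw [heq]
  exact h2.comp h1

/-- **The fibre point over the pairing point is the glued stratum point**:
`fillQ Q ι (∑_p v_p e_p) w = extG G (glue t w)` for `v = pairSubst t`, `G = mergeBy ι M`.
[cite: RudnickSarnak1996, (4.13)–(4.14)] -/
theorem fillQ_pairPoint_pairSubst (t : NewFree Q (mergeBy ι M) → ℝ) (w : Free Q → ℝ) :
    fillQ Q ι (pairPoint M (pairSubst Q ι hι hιs hM t)) w =
      extG (mergeBy ι M) (glue Q (mergeBy ι M) t w) := by
  have hQG : ∀ a, Q.part a ⊆ (mergeBy ι M).part a := part_subset_part_mergeBy Q ι hι hM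
  -- `x ∈ H_G` for the fibre point `x`
  have hsum : ∀ a, ∑ j ∈ (mergeBy ι M).part a,
      fillQ Q ι (pairPoint M (pairSubst Q ι hι hιs hM t)) w j = 0 := by
    intro a
    have hGa : (mergeBy ι M).part a = univ.filter (fun j ↦ rootM M (ι j) = rootM M (ι a)) := by
      ext j
      rw [mergeBy, mem_part_kerPart]
      simp [eq_comm]
    rw [hGa, ← Finset.sum_fiberwise (univ.filter fun j ↦ rootM M (ι j) = rootM M (ι a)) ι
      (fun j ↦ fillQ Q ι (pairPoint M (pairSubst Q ι hι hιs hM t)) w j),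
      ← sum_filter_rootM_pairPoint hM (pairSubst Q ι hι hιs hM t) (rootM M (ι a)), Finset.sum_filter]
    refine Finset.sum_congr rfl fun b _ ↦ ?_
    by_cases hb : rootM M b = rootM M (ι a)
    · rw [if_pos hb]
      obtain ⟨c, hc⟩ := hιs b
      have : (univ.filter fun j ↦ rootM M (ι j) = rootM M (ι a)).filter (fun j ↦ ι j = b) =
          Q.part c := by
        ext j
        simp only [Finset.mem_filter, Finset.mem_univ, true_and, mem_part_iff_label_eq Q ι hι, hc]
        constructor
        · exact fun h ↦ h.2
        · intro h
          exact ⟨by rw [h, hb], h⟩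
      rw [this, sum_part_fillQ Q ι hι, hc]
    · rw [if_neg hb]
      refine Finset.sum_eq_zero fun j hj ↦ ?_
      exfalso
      obtain ⟨hj1, hj2⟩ := Finset.mem_filter.1 hj
      exact hb (hj2 ▸ (Finset.mem_filter.1 hj1).2)
  -- hence `x = extG G (x|Free)`, and `x|Free = glue t w`
  rw [← extG_eq_of_sum_part_eq_zero (mergeBy ι M) _ hsum]
  congr 1
  funext j
  by_cases hjQ : IsRep Q j.1
  · -- a new free index: `j = demRep p`
    obtain ⟨p, hp⟩ := (demRepEquiv Q ι hι hιs hM).surjective ⟨j.1, hjQ, j.2⟩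
    have hpj : demRep ι hιs p = j.1 := by
      have := congrArg Subtype.val hp
      rwa [demRepEquiv_apply] at this
    rw [glue, dif_pos hjQ, fillQ_apply_of_isRep Q ι _ _ hjQ, freeSum]
    congr 1
    rw [show (⟨j.1, hjQ, j.2⟩ : NewFree Q (mergeBy ι M)) = demRepEquiv Q ι hι hιs hM p from hp.symm]
    rcases label_demRep ι hιs p with h | h
    · rw [← hpj, h, pairPoint_apply_fst hM, pairSubst, pairSign, if_pos h, one_mul]
    · rw [← hpj, h, pairPoint_apply_snd hM, pairSubst, pairSign, if_neg ?_]
      · ring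
      · rw [h]
        exact (hM.1 p.1 p.2).ne'
  · rw [glue, dif_neg hjQ, fillQ_apply_of_not_isRep Q ι _ _ hjQ]

/-- **The density at the glued point is `∏ |v_p|`.** [cite: RudnickSarnak1996, Lemma 4.1] -/
theorem dens_extG_glue (t : NewFree Q (mergeBy ι M) → ℝ) (w : Free Q → ℝ) :
    dens Q (mergeBy ι M) (extG (mergeBy ι M) (glue Q (mergeBy ι M) t w)) =
      ∏ p : M, |pairSubst Q ι hι hιs hM t p| := by
  unfold dens
  rw [← Fintype.prod_equiv (demRepEquiv Q ι hι hιs hM) (fun p ↦ |pairSubst Q ι hι hιs hM t p|)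
    (fun j ↦ |∑ i ∈ Q.part j.1, extG (mergeBy ι M) (glue Q (mergeBy ι M) t w) i|)]
  intro p
  rw [sum_part_extG_glue_of_newFree Q (mergeBy ι M) (part_subset_part_mergeBy Q ι hι hM),
    pairSubst, abs_pairSign_mul]

/-- **One term of the pairing functional of the fibre integral as an integral over the merged
stratum**: for continuous compactly supported `Φ` and a partial matching `M` of the labels,
`∫ ∏|v_p| Φ_Q(∑ v_p e_p) dv = ∫ dens Q G (extG G u') Φ(extG G u') du'`, `G = mergeBy ι M`.
[cite: RudnickSarnak1996, Lemma 4.1, (4.13)–(4.14)] -/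
theorem integral_matching_fibreIntegral {Φ : (Fin (k + 1) → ℝ) → ℂ} (hΦc : Continuous Φ)
    (hΦs : HasCompactSupport Φ) :
    (∫ v : M → ℝ, ((∏ p, |v p| : ℝ) : ℂ) * fibreIntegral Q ι Φ (pairPoint M v)) =
      ∫ u' : Free (mergeBy ι M) → ℝ, (dens Q (mergeBy ι M) (extG (mergeBy ι M) u') : ℂ) *
        Φ (extG (mergeBy ι M) u') := by
  have hQG : ∀ a, Q.part a ⊆ (mergeBy ι M).part a := part_subset_part_mergeBy Q ι hι hM
  -- right side: glue
  have hint : Integrable fun u' : Free (mergeBy ι M) → ℝ ↦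
      (dens Q (mergeBy ι M) (extG (mergeBy ι M) u') : ℂ) * Φ (extG (mergeBy ι M) u') := by
    refine Continuous.integrable_of_hasCompactSupport ?_ ?_
    · exact (Complex.continuous_ofReal.comp ((continuous_dens Q (mergeBy ι M)).comp
        (continuous_extG (mergeBy ι M)))).mul (hΦc.comp (continuous_extG (mergeBy ι M)))
    · exact (hasCompactSupport_comp_extG (mergeBy ι M) hΦs).mul_left
  have hR := integral_extG_eq_integral_integral_glue Q (mergeBy ι M) hQG
    (F := fun u ↦ (dens Q (mergeBy ι M) u : ℂ) * Φ u) hint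
  refine Eq.trans ?_ hR.symm
  -- left side: substitute `v = pairSubst t`
  have hgc : Continuous fun v : M → ℝ ↦ ((∏ p, |v p| : ℝ) : ℂ) * fibreIntegral Q ι Φ (pairPoint M v) := by
    refine (Complex.continuous_ofReal.comp
      (continuous_finsetProd _ fun p _ ↦ (continuous_apply p).abs)).mul ?_
    refine (continuous_fibreIntegral Q ι hΦc hΦs).comp ?_
    unfold pairPoint
    exact continuous_finsetSum _ fun p _ ↦ (continuous_apply p).smul continuous_const
  rw [← (measurePreserving_pairSubst Q ι hι hιs hM).map_eq, integral_map
    (measurePreserving_pairSubst Q ι hι hιs hM).measurable.aemeasurable hgc.aestronglyMeasurable]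
  refine integral_congr_ae (Filter.Eventually.of_forall fun t ↦ ?_)
  simp only [fibreIntegral]
  rw [← integral_const_mul]
  refine integral_congr_ae (Filter.Eventually.of_forall fun w ↦ ?_)
  simp only
  rw [fillQ_pairPoint_pairSubst Q ι hι hιs hM t w, dens_extG_glue Q ι hι hιs hM t w]

end main

end RudnickSarnak

end Literature.NumberTheory.LFunctions

end
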